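import Summits.BirchSwinnertonDyer.Rank1Residual.Additive.RamifiedOrdinaryLineTransport
import Summits.BirchSwinnertonDyer.BirchSwinnertonDyer.Theorems.AdditiveBranchIMCGreenbergVatsalResidualBranchTransport
import Literature.NumberTheory.EllipticCurves.SerreOpenImageOrdinaryInertiaProofs
import Literature.NumberTheory.EllipticCurves.SerreOpenImageOfLocalInputProofs
import Literature.NumberTheory.EllipticCurves.IwasawaTowerTorsionProofs
import Mathlib.NumberTheory.LegendreSymbol.QuadraticChar.Basic
import HarnessLib

/-!
# The TAME MIRACLE over `ℚ`: an inertia element with `χ̄_p = a`, `a` a non-square `≠ −1`, has NO non-zero fixed point on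
# `E[p^∞]` for `E = V ⊗ χ_{p*}` with `V[p]|_{I} ⊆ (χ̄_p *; 0 1)` (helper for crux `GordTwoRankZeroOffCaseOne`,
# stmt-BirchSwinnertonDyer-19357, line `three_field_road` v20, stub `stub_tameLocalVanishingR0`; also lines `tame_roads_mult` /
# `wan_tame_bdp_road`)

Stub-worker seat `bsd-addord-k1tame-w2` (gen 0). THEOREMS ONLY (no definition, no named fact). BSD is not proved by any of
this.

Let `V/ℚ` be elliptic, `p` an odd prime, `W = C • V^{(p*)}` a `ℚ`-model of the quadratic twist by `p* = (−1)^{(p−1)/2}p`, and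
`I ≤ Γ_ℚ` a subgroup acting on `V[p]` through a Borel with TRIVIAL quotient character: a line `𝔽_p v₀ ⊆ V[p]` with
`τx − x ∈ 𝔽_p v₀` for all `τ ∈ I`, `x ∈ V[p]` (for `V` good ORDINARY at `p` and `I = I_𝔏`, `𝔏 ∣ p`, this is Serre 1972
§1.11 Cor. of Prop. 11, tree `exists_line_of_not_dvd_frobeniusTrace_of_mem_primesAbove`; for `V` multiplicative at `p` it is
the Tate curve). Then:

* §1 `smul_eq_modNCyclotomicCharacter_smul_of_line` — `τ v₀ = χ̄_p(τ) v₀` for EVERY `τ ∈ I` (Weil pairing: `det ρ̄_{V,p} =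
  χ̄_p`, tree `exists_frame_galoisRepTorsion_rat` + `det_eq_of_sub_mem_line`; Serre §1.11 "`χ_X χ_Y = det`").
* §2 `exists_nonsquare_ne_neg_one` — for `p ≥ 5` there is `a ∈ 𝔽_pˣ` with `(a/p) = −1` and `a ≠ −1` (of the two non-squares
  `a₀, 4a₀` at most one is `−1`, else `3a₀ = 0`).
* §3 **`eq_zero_of_smul_eq_of_pStar_twist`** — if `τ ∈ I` has `χ̄_p(τ) = a` with `(a/p) = −1` and `a ≠ −1`, then every
  `m ∈ W[p^∞]` with `τ m = m` is `0`. Proof: `τ√p* = (χ̄_p(τ)/p)√p* = −√p*` (Gauss sum, tree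
  `ite_smul_geomSqrt_pStar_eq_quadraticChar`), so along the signed twisting isomorphism `e : V[p^∞] ≃ W[p^∞]` (Silverman X.5.4,
  tree `exists_addEquiv_geomPrimaryTorsion_of_model_twist_sign`) a `τ`-fixed `m ≠ 0` of order `p` (w.l.o.g., `p^j m`) gives
  `y ∈ V[p] ∖ 0` with `τ y = −y`; then `−2y = τy − y ∈ 𝔽_p v₀` puts `y = c v₀`, so `τ y = χ̄_p(τ) y`, i.e. `(a + 1) y = 0`,
  `a = −1` — contradiction. (On `E[p] ≅ V[p] ⊗ χ_{p*}` the element `τ` has eigenvalues `−a, −1`, neither `= 1`.)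

References: [Serre1972] §1.11 Prop. 11 and Cor., §1.12; [SilvermanAEC2009] X.5 Cor. 5.4, III.8.1; [IrelandRosen1990] Prop. 6.3.2.
-/

set_option linter.dupNamespace false

noncomputable section

open scoped Classical NumberField Matrix
open Field NumberField IsDedekindDomain WeierstrassCurve
open Literature.NumberTheory.GaloisRepresentations Literature.NumberTheory.EllipticCurves
  Summit.BirchSwinnertonDyer.Rank1Residual.Additive
  Summit.BirchSwinnertonDyer.BirchSwinnertonDyer.Theorems.AdditiveBranchIMCGreenbergVatsalResidualBranchTransport

namespace Summit.BirchSwinnertonDyer.BirchSwinnertonDyer.Theorems.TameLocalVanishing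

/-! ### §1 The character on the line is `χ̄_p` for EVERY element acting trivially on the quotient -/

section Line

variable (V : WeierstrassCurve ℚ) [V.IsElliptic] (p : ℕ) [hp : Fact p.Prime]

/-- **`τ v₀ = χ̄_p(τ) v₀` on a line with trivial quotient character** (Serre 1972, §1.11, proof of Prop. 11: "`χ_X χ_Y = det =
χ̄_p`"). For `E = V/ℚ` elliptic, a subgroup `I ≤ Γ_ℚ` and `v₀ ∈ V[p] ∖ 0` with `τ x − x ∈ 𝔽_p v₀` for all `τ ∈ I`, `x ∈ V[p]`:
every `τ ∈ I` acts on `v₀` by the mod-`p` cyclotomic character, `τ v₀ = det ρ̄_{V,p}(τ) v₀ = χ̄_p(τ) v₀` (Weil pairing, tree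
`exists_frame_galoisRepTorsion_rat`, `det_eq_of_sub_mem_line`). [cite: Serre1972, §1.11 Prop. 11 and Cor.]
[cite: SilvermanAEC2009, III.8 Prop. 8.1] -/
theorem smul_eq_modNCyclotomicCharacter_smul_of_line {I : Subgroup (absoluteGaloisGroup ℚ)}
    {v₀ : geomTorsion V p} (hv₀ : v₀ ≠ 0)
    (hquot : letI : Module (ZMod p) (geomTorsion V p) := AddSubgroup.torsionBy.zmodModule
      ∀ τ ∈ I, ∀ x : geomTorsion V p, ∃ b : ZMod p, τ • x - x = b • v₀)
    {τ : absoluteGaloisGroup ℚ} (hτ : τ ∈ I) :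
    letI : Module (ZMod p) (geomTorsion V p) := AddSubgroup.torsionBy.zmodModule
    τ • v₀ = ((modNCyclotomicCharacter ℚ p τ : (ZMod p)ˣ) : ZMod p) • v₀ := by
  letI : Module (ZMod p) (geomTorsion V p) := AddSubgroup.torsionBy.zmodModule
  have hpr : p.Prime := hp.out
  haveI : NeZero p := ⟨hpr.ne_zero⟩
  obtain ⟨e, Φ, he, -, -, -, -⟩ := exists_frame_galoisRepTorsion_rat V p
  obtain ⟨b₀, hb₀⟩ := hquot τ hτ v₀
  set c : ZMod p := 1 + b₀ with hc
  have hτv : τ • v₀ = c • v₀ := by rw [hc, add_smul, one_smul, ← hb₀, add_sub_cancel]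
  suffices hca : c = ((modNCyclotomicCharacter ℚ p τ : (ZMod p)ˣ) : ZMod p) by rw [hτv, hca]
  have hev₀ : e v₀ ≠ 0 := fun h0 ↦ hv₀ (e.injective (h0.trans (map_zero e).symm))
  have hg : ((Φ (galoisRepTorsion V p τ) : GL (Fin 2) (ZMod p)) :
      Matrix (Fin 2) (Fin 2) (ZMod p)) *ᵥ e v₀ = c • e v₀ := by
    rw [← he, ← ZMod.map_smul e c v₀, ← hτv]
    rfl
  have hgq : ∀ w : Fin 2 → ZMod p, ∃ b : ZMod p, ((Φ (galoisRepTorsion V p τ) :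
      GL (Fin 2) (ZMod p)) : Matrix (Fin 2) (Fin 2) (ZMod p)) *ᵥ w - w = b • e v₀ := by
    intro w
    obtain ⟨b, hb⟩ := hquot τ hτ (e.symm w)
    refine ⟨b, ?_⟩
    have h1 := congrArg e hb
    rw [map_sub, ZMod.map_smul e b v₀, AddEquiv.apply_symm_apply] at h1
    have h2 : e (τ • e.symm w) = ((Φ (galoisRepTorsion V p τ) : GL (Fin 2) (ZMod p)) :
        Matrix (Fin 2) (Fin 2) (ZMod p)) *ᵥ w := by
      rw [show τ • e.symm w = Multiplicative.toAdd (galoisRepTorsion V p τ) (e.symm w) from rfl, he,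
        AddEquiv.apply_symm_apply]
    rw [← h1, h2]
  have h1 := det_eq_of_sub_mem_line hev₀ hg hgq
  rw [← h1, det_frame_galoisRepTorsion_eq V p e Φ he τ,
    modPCyclotomicCharacterZMod_eq_modNCyclotomicCharacter]

end Line

/-! ### §2 A non-square `a ≠ −1` modulo `p ≥ 5` -/

/-- **For a prime `p ≥ 5` there is `a ∈ 𝔽_p` with `(a/p) = −1` and `a ≠ −1`.** Take a non-square `a₀` (Mathlib
`quadraticChar_exists_neg_one`); `4a₀` is again a non-square, and `a₀ = −1 = 4a₀` would force `3 = 0` in `𝔽_p`. [folklore] -/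
theorem exists_nonsquare_ne_neg_one {p : ℕ} [hp : Fact p.Prime] (hp5 : 5 ≤ p) :
    ∃ a : ZMod p, quadraticChar (ZMod p) a = -1 ∧ a ≠ -1 := by
  have hpr : p.Prime := hp.out
  have hp2 : ringChar (ZMod p) ≠ 2 := by rw [ZMod.ringChar_zmod_n]; omega
  obtain ⟨a₀, ha₀⟩ := quadraticChar_exists_neg_one (F := ZMod p) hp2
  by_cases h : a₀ = -1
  · refine ⟨4 * a₀, ?_, ?_⟩
    · have h4 : quadraticChar (ZMod p) 4 = 1 := by
        have h20 : (2 : ZMod p) ≠ 0 := by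
          have : ((2 : ℕ) : ZMod p) ≠ 0 := by
            rw [ne_eq, ZMod.natCast_eq_zero_iff]
            intro hdvd
            have := (Nat.prime_dvd_prime_iff_eq hpr Nat.prime_two).mp hdvd
            omega
          exact_mod_cast this
        rw [show (4 : ZMod p) = 2 ^ 2 by norm_num]
        exact quadraticChar_sq_one' h20
      rw [map_mul, h4, one_mul, ha₀]
    · intro h4
      rw [h] at h4
      have h3 : ((3 : ℕ) : ZMod p) = 0 := by
        have : (4 : ZMod p) * (-1) - (-1) = 0 := by rw [h4, sub_self]
        have e3 : ((3 : ℕ) : ZMod p) = -((4 : ZMod p) * (-1) - (-1)) := by push_cast; ring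
        rw [e3, this, neg_zero]
      rw [ZMod.natCast_eq_zero_iff] at h3
      have := (Nat.prime_dvd_prime_iff_eq hpr Nat.prime_three).mp h3
      omega
  · exact ⟨a₀, ha₀, h⟩

/-! ### §3 The tame miracle: no `τ`-fixed points on `E[p^∞]`, `E = V ⊗ χ_{p*}` -/

section Twist

variable (V : WeierstrassCurve ℚ) [V.IsElliptic] {W : WeierstrassCurve ℚ} (p : ℕ) [hp : Fact p.Prime]

/-- **THE TAME MIRACLE (over `ℚ`).** Let `V/ℚ` be elliptic, `p` odd, `W = C • V^{(p*)}` (`p* = (−1)^{⌊p/2⌋}p`) a model of the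
quadratic twist, `I ≤ Γ_ℚ` a subgroup with a line `𝔽_p v₀ ⊆ V[p]`, `v₀ ≠ 0`, such that `τx − x ∈ 𝔽_p v₀` for all `τ ∈ I`,
`x ∈ V[p]` (inertia at a good ORDINARY or multiplicative `p`: Serre 1972 §1.11–1.12). If `τ ∈ I` has mod-`p` cyclotomic
character `a = χ̄_p(τ)` with `(a/p) = −1` and `a ≠ −1`, then `τ` has NO non-zero fixed point on `W[p^∞]`: on
`W[p] ≅ V[p] ⊗ χ_{p*}` (`χ_{p*}(τ) = (a/p) = −1`, Gauss sum) its eigenvalues are `−a` and `−1`, neither `1`. Proof in the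
docstring of the module. [cite: Serre1972, §1.11 Prop. 11 and Cor.] [cite: SilvermanAEC2009, X.5 Cor. 5.4]
[cite: IrelandRosen1990, Ch. 6 Prop. 6.3.2] -/
theorem eq_zero_of_smul_eq_of_pStar_twist (hp2 : p ≠ 2)
    (hCW : ∃ C : VariableChange ℚ, C • V.quadraticTwist ((-1 : ℚ) ^ (p / 2) * p) = W)
    {I : Subgroup (absoluteGaloisGroup ℚ)}
    (hline : letI : Module (ZMod p) (geomTorsion V p) := AddSubgroup.torsionBy.zmodModule
      ∃ v₀ : geomTorsion V p, v₀ ≠ 0 ∧ ∀ τ ∈ I, ∀ x : geomTorsion V p, ∃ b : ZMod p, τ • x - x = b • v₀)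
    {τ : absoluteGaloisGroup ℚ} (hτ : τ ∈ I)
    (hχ : quadraticChar (ZMod p) ((modNCyclotomicCharacter ℚ p τ : (ZMod p)ˣ) : ZMod p) = -1)
    (hne : ((modNCyclotomicCharacter ℚ p τ : (ZMod p)ˣ) : ZMod p) ≠ -1)
    {m : W.geomPrimaryTorsion p} (hm : τ • m = m) : m = 0 := by
  letI : Module (ZMod p) (geomTorsion V p) := AddSubgroup.torsionBy.zmodModule
  have hpr : p.Prime := hp.out
  haveI : NeZero p := ⟨hpr.ne_zero⟩
  set d : ℚ := (-1 : ℚ) ^ (p / 2) * p with hd_def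
  have hd : d ≠ 0 := mul_ne_zero (pow_ne_zero _ (by norm_num)) (by exact_mod_cast hpr.ne_zero)
  -- the sign of `τ` on `√p*` is `−1`
  have hsign : τ • geomSqrt d = -geomSqrt d := by
    have h := ite_smul_geomSqrt_pStar_eq_quadraticChar hp2 τ
    rw [hχ] at h
    have hne' : ¬ τ • geomSqrt d = geomSqrt d := fun heq ↦ by
      rw [hd_def] at heq
      rw [if_pos heq] at h
      norm_num at h
    exact (smul_geomSqrt_eq_or τ d).resolve_left hne'
  -- the signed twisting isomorphism `e : V[p^∞] ≃ W[p^∞]`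
  obtain ⟨e, -, -, hneg⟩ := exists_addEquiv_geomPrimaryTorsion_of_model_twist_sign (p := p) V hd hCW
  by_contra h0
  -- w.l.o.g. `m` has order `p`
  obtain ⟨j, hm₁0, hpm₁⟩ := W.exists_pow_smul_ne_zero_and_p_smul_eq_zero h0
  set m₁ : W.geomPrimaryTorsion p := p ^ j • m with hm₁
  have hτm₁ : τ • m₁ = m₁ := by rw [hm₁, smul_comm, hm]
  -- pull back to `V[p^∞]`: `τ n = −n`
  set n : V.geomPrimaryTorsion p := e.symm m₁ with hn
  have hen : e n = m₁ := e.apply_symm_apply m₁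
  have hn0 : n ≠ 0 := fun h ↦ hm₁0 (by rw [← hen, h, map_zero])
  have hpn : p • n = 0 := e.injective (by rw [map_nsmul, hen, hpm₁, map_zero])
  have hτn : τ • n = -n := e.injective (by rw [hneg τ hsign n, hen, hτm₁, map_neg, hen])
  -- as an element `y` of `V[p]`
  have hpn' : (p : ℤ) • (n : geomPoints V) = 0 := by
    rw [natCast_zsmul, ← AddSubmonoidClass.coe_nsmul, hpn, ZeroMemClass.coe_zero]
  have hnmem : (n : geomPoints V) ∈ geomTorsion V p := (Submodule.mem_torsionBy_iff _ _).mpr hpn'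
  set y : geomTorsion V p := ⟨(n : geomPoints V), hnmem⟩ with hy
  have hy0 : y ≠ 0 := by
    intro h
    have h' : ((y : geomTorsion V p) : geomPoints V) = 0 := by rw [h, ZeroMemClass.coe_zero]
    exact hn0 (Subtype.ext h')
  have hτy : τ • y = -y := by
    apply Subtype.ext
    rw [AddSubgroup.torsionBy.coe_smul, NegMemClass.coe_neg]
    change τ • (n : geomPoints V) = -(n : geomPoints V)
    rw [← primaryComponent.coe_smul, hτn, NegMemClass.coe_neg]
  -- `−2y = τy − y ∈ 𝔽_p v₀`, so `y = c v₀`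
  obtain ⟨v₀, hv₀, hquot⟩ := hline
  obtain ⟨b, hb⟩ := hquot τ hτ y
  rw [hτy] at hb
  have h2 : (-2 : ZMod p) ≠ 0 := by
    rw [ne_eq, neg_eq_zero]
    have : ((2 : ℕ) : ZMod p) ≠ 0 := by
      rw [ne_eq, ZMod.natCast_eq_zero_iff]
      intro hdvd
      exact hp2 ((Nat.prime_dvd_prime_iff_eq hpr Nat.prime_two).mp hdvd)
    exact_mod_cast this
  have hy2 : (-2 : ZMod p) • y = b • v₀ := by
    rw [← hb, show (-2 : ZMod p) = -1 + -1 by norm_num, add_smul, neg_one_smul, sub_eq_add_neg]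
  set c : ZMod p := (-2 : ZMod p)⁻¹ * b with hc
  have hyc : y = c • v₀ := by
    rw [hc, mul_smul, ← hy2, ← mul_smul, inv_mul_cancel₀ h2, one_smul]
  -- `τ y = c χ̄_p(τ) v₀ = χ̄_p(τ) y`, so `(χ̄_p(τ) + 1) y = 0`
  set a : ZMod p := ((modNCyclotomicCharacter ℚ p τ : (ZMod p)ˣ) : ZMod p) with ha
  have hτv₀ := smul_eq_modNCyclotomicCharacter_smul_of_line V p hv₀ hquot hτ
  have hτy' : τ • y = a • y := by
    rw [hyc]
    change DistribSMul.toAddMonoidHom (geomTorsion V p) τ (c • v₀) = a • c • v₀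
    rw [ZMod.map_smul, DistribSMul.toAddMonoidHom_apply, hτv₀, ← ha, smul_comm]
  have hsum : (a + 1) • y = 0 := by rw [add_smul, one_smul, ← hτy', hτy, neg_add_cancel]
  have ha1 : a + 1 = 0 := by
    by_contra hne1
    exact hy0 (by rw [← one_smul (ZMod p) y, ← inv_mul_cancel₀ hne1, mul_smul, hsum, smul_zero])
  exact hne (eq_neg_of_add_eq_zero_left ha1)

end Twist

end Summit.BirchSwinnertonDyer.BirchSwinnertonDyer.Theorems.TameLocalVanishing

end
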